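import Literature.AlgebraicGeometry.HodgeTheory.QuaternionicQuarticCover
import HarnessLib

/-!
# The étale chart of the normalised quaternionic quartic cover, with its REGULAR action of `Q₈`
# by signed permutations (programme «M1», brick M1-0a)

Layer `Literature/AlgebraicGeometry/HodgeTheory`. Definitions + proved API (no named fact). Written by the prover
seat `hodge-nonav-prover-Bx` (g19, cell `hodge-nonav`) as brick **M1-0a «DECK CHART»** of programme M1 («the deck
pair on a smooth projective family model», memo `PROGRAMME-M1-Bx-g19.md`; planner decision p3 g36 2026-08-29T08:41:37Z)
for route `HodgeConjecture/Q8SymplecticPowers` (crux K1Q, stmt-HodgeConjecture-24190).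

The route's surfaces are models of the quartic multiple plane `V_(c,ψ) : x₃⁴ x₂^{2e} = c (σc)³ ((x₀ − x₁) ψ)²`
(`QuaternionicQuarticFamily`, `QuaternionicQuarticCover`), on which the quaternion group `Q₈ = ⟨τ, j⟩` acts
BIRATIONALLY: `τ : x₃ ↦ i x₃` is regular, `j` (the swap `σ` of `x₀, x₁` followed by `x₃ ↦ φ/x₃`) is not. On the
NORMALISATION of the affine piece `x₂ ≠ 0` the action becomes regular, and on its étale locus it is given by SIGNED
PERMUTATIONS of six natural generators. In affine coordinates `u₀ = x₀/x₂`, `u₁ = x₁/x₂` put (dehomogenising at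
`x₂ = 1`) `c`, `σc`, `α = u₀ − u₁`, `ψ`, `g = c (σc)³ α² ψ²`, `h = c (σc) α ψ`; the normalisation of
`ℂ[u₀, u₁][w]/(w⁴ − g)` has the `ℂ[u]`-basis `1, w, w₁ = w²/(σc α ψ), w₂ = w w₁/σc`, and with `v = 1/h` the
étale chart is

  `deckRing a = R[u₀, u₁, w, w₁, w₂, v] / (r₁, …, r₇)`,
  `r₁ = w₁² − c σc`, `r₂ = w² − w₁ σc α ψ`, `r₃ = w₂² − w₁ c α ψ`, `r₄ = w w₁ − w₂ σc`, `r₅ = w₁ w₂ − w c`,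
  `r₆ = w w₂ − h`, `r₇ = v h − 1`,

for a coefficient vector `a : CIdx e → R` with values in any commutative `ℂ`-algebra `R` (universal case
`R = A = ℂ[a]`, `a = X`; complex points `R = ℂ`; generic point `R = Frac A`). The action:

  `τ₀ : (u₀, u₁, w, w₁, w₂, v) ↦ (u₀, u₁, i w, −w₁, −i w₂, v)`,
  `j₀ : (u₀, u₁, w, w₁, w₂, v) ↦ (u₁, u₀, w₂, −w₁, −w, −v)`,

maps `(r₁, …, r₇)` to `(r₁, −r₂, −r₃, −i r₄, i r₅, r₆, r₇)` resp. `(r₁, r₃, r₂, −r₅, r₄, −r₆, r₇)`, so the ideal is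
visibly stable, and the relations `τ₀⁴ = 1`, `j₀² = τ₀²`, `τ₀ j₀ τ₀ = j₀` already hold on the polynomial ring. This
file provides:

* `dehom`, `cU`, `cU'`, `αU`, `ψU`, `gU`, `hU`, the relations `rel a k`, the ideal `deckIdeal a` and the ring
  `DeckRing a`; the substitutions `tauPoly`, `jPoly` with their values on the generators and on `c, σc, α, ψ, h`,
  the stability `deckIdeal_le_comap_tauPoly` / `deckIdeal_le_comap_jPoly` and the three relations
  `tauPoly_pow_four`, `jPoly_comp_jPoly`, `tauPoly_comp_jPoly_comp_tauPoly` on the polynomial ring.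

Companion files: M1-0a (part 2) `QuaternionicQuarticDeckChartAction` — the induced `R`-algebra automorphisms of
`DeckRing a`, the homomorphism `QuaternionGroup 2 →* (DeckRing a ≃ₐ[R] DeckRing a)` and the action of `Q₈` on the
chart `Spec (DeckRing a)` OVER `Spec R` (the tree's `RelativeSpec.ActionOver`, the input format of
`Motives.finiteQuotient`); then the dictionary `DeckRing a ≃ (R[u][w]/(w⁴ − g))[1/h]`, integrality and smoothness,
base change in `R`, and the open immersion into `cover e` (M1-1). Honest scope: explicit commutative algebra for one
family of surfaces; nothing here bears on HC.

## References

* [Kollar2007] J. Kollár, Lectures on Resolution of Singularities (2007), §3.3 (the family), §3.4.1 (group actions).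
* [EGAIV3] A. Grothendieck, J. Dieudonné, EGA IV₃ (1966), §8 (the chart as an input of spreading out).
* [Hartshorne1977] R. Hartshorne, Algebraic Geometry (1977), II Ex. 2.9–2.14 (affine schemes and ring automorphisms).
-/

noncomputable section

open CategoryTheory AlgebraicGeometry MvPolynomial


namespace Literature.AlgebraicGeometry.HodgeTheory.Q8Family

universe v

/-! ### The chart algebra -/

section Chart

variable {R : Type v} [CommRing R] {e : ℕ} (a : CIdx e → R)

/-- Dehomogenisation at `x₂ = 1` into the chart variables `u₀ = X 0`, `u₁ = X 1` of `R[u₀, u₁, w, w₁, w₂, v]`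
(`= MvPolynomial (Fin 6) R`, indices `0, …, 5` in this order). [cite: Hartshorne1977, II Ex. 2.14] -/
def dehom : MvPolynomial (Fin 3) R →ₐ[R] MvPolynomial (Fin 6) R :=
  aeval ![X 0, X 1, 1]

/-- `c(u₀, u₁, 1)`. [cite: Kollar2007, §3.3] -/
def cU : MvPolynomial (Fin 6) R := dehom (cOfR a)

/-- `(σc)(u₀, u₁, 1) = c(u₁, u₀, 1)`. [cite: Kollar2007, §3.3] -/
def cU' : MvPolynomial (Fin 6) R := dehom (rename (Equiv.swap (0 : Fin 3) 1) (cOfR a))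

/-- `α = u₀ − u₁`. [cite: Kollar2007, §3.3] -/
def αU : MvPolynomial (Fin 6) R := X 0 - X 1

/-- `ψ(u₀, u₁, 1)` (σ-invariant). [cite: Kollar2007, §3.3] -/
def ψU : MvPolynomial (Fin 6) R := dehom (ψOfR a)

/-- `g = c (σc)³ α² ψ²`, the right-hand side of `w⁴ = g`. [cite: Kollar2007, §3.3] -/
def gU : MvPolynomial (Fin 6) R := cU a * cU' a ^ 3 * αU ^ 2 * ψU a ^ 2

/-- `h = c (σc) α ψ`, the reduced branch equation (inverted on the chart). [cite: Kollar2007, §3.3] -/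
def hU : MvPolynomial (Fin 6) R := cU a * cU' a * αU * ψU a

/-- The seven relations `r₁, …, r₇` of the chart (indexed by `Fin 7`). [cite: Kollar2007, §3.3] -/
def rel : Fin 7 → MvPolynomial (Fin 6) R
  | 0 => X 3 ^ 2 - cU a * cU' a
  | 1 => X 2 ^ 2 - X 3 * cU' a * αU * ψU a
  | 2 => X 4 ^ 2 - X 3 * cU a * αU * ψU a
  | 3 => X 2 * X 3 - X 4 * cU' a
  | 4 => X 3 * X 4 - X 2 * cU a
  | 5 => X 2 * X 4 - hU a
  | 6 => X 5 * hU a - 1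

/-- The ideal `(r₁, …, r₇)` of the chart. [cite: Kollar2007, §3.3] -/
def deckIdeal : Ideal (MvPolynomial (Fin 6) R) := Ideal.span (Set.range (rel a))

/-- **The coordinate ring of the étale chart of the normalised quaternionic quartic cover**,
`R[u₀, u₁, w, w₁, w₂, v]/(r₁, …, r₇)`. [cite: Kollar2007, §3.3] -/
abbrev DeckRing : Type v := MvPolynomial (Fin 6) R ⧸ deckIdeal a

/-- Each relation lies in the ideal. [cite: Kollar2007, §3.3] -/
theorem rel_mem_deckIdeal (k : Fin 7) : rel a k ∈ deckIdeal a := Ideal.subset_span ⟨k, rfl⟩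

end Chart

/-! ### The substitution `j₀` on the polynomial ring (no `√−1` needed) -/

section SubstJ

variable {R : Type v} [CommRing R] {e : ℕ} (a : CIdx e → R)

/-- `j₀ : (u₀, u₁, w, w₁, w₂, v) ↦ (u₁, u₀, w₂, −w₁, −w, −v)`. [cite: Kollar2007, §3.4.1] -/
def jPoly (R : Type v) [CommRing R] : MvPolynomial (Fin 6) R →ₐ[R] MvPolynomial (Fin 6) R :=
  aeval ![X 1, X 0, X 4, -X 3, -X 2, -X 5]

/-- `j₀` on the generator `X 0`. [cite: Kollar2007, §3.4.1] -/
@[simp] theorem jPoly_X0 : jPoly R (X 0) = X 1 := by simp [jPoly]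
/-- `j₀` on the generator `X 1`. [cite: Kollar2007, §3.4.1] -/
@[simp] theorem jPoly_X1 : jPoly R (X 1) = X 0 := by simp [jPoly]
/-- `j₀` on the generator `X 2`. [cite: Kollar2007, §3.4.1] -/
@[simp] theorem jPoly_X2 : jPoly R (X 2) = X 4 := by simp [jPoly]
/-- `j₀` on the generator `X 3`. [cite: Kollar2007, §3.4.1] -/
@[simp] theorem jPoly_X3 : jPoly R (X 3) = -X 3 := by simp [jPoly]
/-- `j₀` on the generator `X 4`. [cite: Kollar2007, §3.4.1] -/
@[simp] theorem jPoly_X4 : jPoly R (X 4) = -X 2 := by simp [jPoly]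
/-- `j₀` on the generator `X 5`. [cite: Kollar2007, §3.4.1] -/
@[simp] theorem jPoly_X5 : jPoly R (X 5) = -X 5 := by simp [jPoly]

/-- `σ ∘ σ = id` on `Fin 3`. [folklore] -/
private theorem swap_comp_swap : (⇑(Equiv.swap (0 : Fin 3) 1) ∘ ⇑(Equiv.swap (0 : Fin 3) 1)) = id := by
  ext i
  simp [Equiv.swap_apply_self]

/-- `j₀` acts on the dehomogenised forms as the swap `σ` of `x₀, x₁`. [cite: Kollar2007, §3.4.1] -/
theorem jPoly_dehom (p : MvPolynomial (Fin 3) R) :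
    jPoly R (dehom p) = dehom (rename (Equiv.swap (0 : Fin 3) 1) p) := by
  change ((jPoly R).comp dehom) p = (dehom.comp (rename (Equiv.swap (0 : Fin 3) 1))) p
  congr 1
  refine MvPolynomial.algHom_ext fun i => ?_
  fin_cases i <;> simp [jPoly, dehom, Equiv.swap_apply_of_ne_of_ne]

/-- `j₀ c = σc`. [cite: Kollar2007, §3.4.1] -/
@[simp] theorem jPoly_cU : jPoly R (cU a) = cU' a := jPoly_dehom _

/-- `j₀ (σc) = c`. [cite: Kollar2007, §3.4.1] -/
@[simp] theorem jPoly_cU' : jPoly R (cU' a) = cU a := by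
  rw [cU', jPoly_dehom, rename_rename, swap_comp_swap, rename_id, AlgHom.id_apply, cU]

/-- `j₀ α = −α`. [cite: Kollar2007, §3.4.1] -/
@[simp] theorem jPoly_αU : jPoly R (αU : MvPolynomial (Fin 6) R) = -αU := by
  simp only [αU, map_sub, jPoly_X0, jPoly_X1, neg_sub]

/-- `j₀ ψ = ψ` (`ψ` is σ-invariant by construction). [cite: Kollar2007, §3.4.1] -/
@[simp] theorem jPoly_ψU : jPoly R (ψU a) = ψU a := by
  rw [ψU, jPoly_dehom, ψOfR, map_add, rename_rename, swap_comp_swap, rename_id, AlgHom.id_apply, add_comm]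

/-- `j₀ h = −h`. [cite: Kollar2007, §3.4.1] -/
@[simp] theorem jPoly_hU : jPoly R (hU a) = -hU a := by
  simp only [hU, map_mul, jPoly_cU, jPoly_cU', jPoly_αU, jPoly_ψU]; ring

/-- A multiple of a relation lies in the ideal. [folklore] -/
private theorem mem_deckIdeal_of_eq_mul {p u : MvPolynomial (Fin 6) R} (k : Fin 7) (h : p = u * rel a k) :
    p ∈ deckIdeal a := by
  rw [h]; exact Ideal.mul_mem_left _ u (rel_mem_deckIdeal a k)

/-- `j₀` maps every relation into the ideal: `(r₁, …, r₇) ↦ (r₁, r₃, r₂, −r₅, r₄, −r₆, r₇)`.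
[cite: Kollar2007, §3.4.1] -/
theorem jPoly_rel_mem (k : Fin 7) : jPoly R (rel a k) ∈ deckIdeal a := by
  fin_cases k
  · exact mem_deckIdeal_of_eq_mul a 0 (u := 1) (by simp [rel]; ring)
  · exact mem_deckIdeal_of_eq_mul a 2 (u := 1) (by simp [rel])
  · exact mem_deckIdeal_of_eq_mul a 1 (u := 1) (by simp [rel])
  · exact mem_deckIdeal_of_eq_mul a 4 (u := -1) (by simp [rel]; ring)
  · exact mem_deckIdeal_of_eq_mul a 3 (u := 1) (by simp [rel]; ring)
  · exact mem_deckIdeal_of_eq_mul a 5 (u := -1) (by simp [rel]; ring)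
  · exact mem_deckIdeal_of_eq_mul a 6 (u := 1) (by simp [rel])

/-- The ideal is `j₀`-stable. [cite: Kollar2007, §3.4.1] -/
theorem deckIdeal_le_comap_jPoly : deckIdeal a ≤ (deckIdeal a).comap (jPoly R) := by
  rw [deckIdeal, Ideal.span_le]
  rintro _ ⟨k, rfl⟩
  exact jPoly_rel_mem a k

end SubstJ

/-! ### The substitution `τ₀` on the polynomial ring (over a `ℂ`-algebra) and the relations -/

section SubstTau

variable {R : Type v} [CommRing R] [Algebra ℂ R] {e : ℕ} (a : CIdx e → R)

/-- `i = √−1` in the `ℂ`-algebra `R` (the scalar by which `τ` acts on `w = x₃/x₂`). [cite: Kollar2007, §3.4.1] -/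
def iR (R : Type v) [CommRing R] [Algebra ℂ R] : R := algebraMap ℂ R Complex.I

omit a in
/-- `i² = −1` in `R`. [cite: Kollar2007, §3.4.1] -/
@[simp] theorem iR_mul_iR : iR R * iR R = -1 := by
  rw [iR, ← map_mul, Complex.I_mul_I, map_neg, map_one]

/-- `(C i)² = −1` in the polynomial ring. [cite: Kollar2007, §3.4.1] -/
theorem C_iR_mul_C_iR : (C (iR R) * C (iR R) : MvPolynomial (Fin 6) R) = -1 := by
  rw [← C_mul, iR_mul_iR, C_neg, C_1]

/-- `τ₀ : (u₀, u₁, w, w₁, w₂, v) ↦ (u₀, u₁, i w, −w₁, −i w₂, v)`. [cite: Kollar2007, §3.4.1] -/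
def tauPoly (R : Type v) [CommRing R] [Algebra ℂ R] : MvPolynomial (Fin 6) R →ₐ[R] MvPolynomial (Fin 6) R :=
  aeval ![X 0, X 1, C (iR R) * X 2, -X 3, -(C (iR R) * X 4), X 5]

/-- `τ₀` on the generator `X 0`. [cite: Kollar2007, §3.4.1] -/
@[simp] theorem tauPoly_X0 : tauPoly R (X 0) = X 0 := by simp [tauPoly]
/-- `τ₀` on the generator `X 1`. [cite: Kollar2007, §3.4.1] -/
@[simp] theorem tauPoly_X1 : tauPoly R (X 1) = X 1 := by simp [tauPoly]
/-- `τ₀` on the generator `X 2`. [cite: Kollar2007, §3.4.1] -/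
@[simp] theorem tauPoly_X2 : tauPoly R (X 2) = C (iR R) * X 2 := by simp [tauPoly]
/-- `τ₀` on the generator `X 3`. [cite: Kollar2007, §3.4.1] -/
@[simp] theorem tauPoly_X3 : tauPoly R (X 3) = -X 3 := by simp [tauPoly]
/-- `τ₀` on the generator `X 4`. [cite: Kollar2007, §3.4.1] -/
@[simp] theorem tauPoly_X4 : tauPoly R (X 4) = -(C (iR R) * X 4) := by simp [tauPoly]
/-- `τ₀` on the generator `X 5`. [cite: Kollar2007, §3.4.1] -/
@[simp] theorem tauPoly_X5 : tauPoly R (X 5) = X 5 := by simp [tauPoly]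

/-- `τ₀` fixes everything dehomogenised from `ℂ[x₀, x₁, x₂]` (it moves only `w, w₁, w₂`). [cite: Kollar2007, §3.4.1] -/
theorem tauPoly_dehom (p : MvPolynomial (Fin 3) R) : tauPoly R (dehom p) = dehom p := by
  change ((tauPoly R).comp dehom) p = dehom p
  congr 1
  refine MvPolynomial.algHom_ext fun i => ?_
  fin_cases i <;> simp [tauPoly, dehom]

/-- `τ₀ c = c`. [cite: Kollar2007, §3.4.1] -/
@[simp] theorem tauPoly_cU : tauPoly R (cU a) = cU a := tauPoly_dehom _
/-- `τ₀ (σc) = σc`. [cite: Kollar2007, §3.4.1] -/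
@[simp] theorem tauPoly_cU' : tauPoly R (cU' a) = cU' a := tauPoly_dehom _
/-- `τ₀ ψ = ψ`. [cite: Kollar2007, §3.4.1] -/
@[simp] theorem tauPoly_ψU : tauPoly R (ψU a) = ψU a := tauPoly_dehom _
/-- `τ₀ α = α`. [cite: Kollar2007, §3.4.1] -/
@[simp] theorem tauPoly_αU : tauPoly R (αU : MvPolynomial (Fin 6) R) = αU := by
  simp only [αU, map_sub, tauPoly_X0, tauPoly_X1]
/-- `τ₀ h = h`. [cite: Kollar2007, §3.4.1] -/
@[simp] theorem tauPoly_hU : tauPoly R (hU a) = hU a := by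
  simp only [hU, map_mul, tauPoly_cU, tauPoly_cU', tauPoly_αU, tauPoly_ψU]

/-- `τ₀` maps every relation into the ideal: `(r₁, …, r₇) ↦ (r₁, −r₂, −r₃, −i r₄, i r₅, r₆, r₇)`.
[cite: Kollar2007, §3.4.1] -/
theorem tauPoly_rel_mem (k : Fin 7) : tauPoly R (rel a k) ∈ deckIdeal a := by
  have h := C_iR_mul_C_iR (R := R)
  fin_cases k
  · exact mem_deckIdeal_of_eq_mul a 0 (u := 1) (by simp [rel])
  · exact mem_deckIdeal_of_eq_mul a 1 (u := -1)
      (by simp [rel]; linear_combination (X 2 ^ 2 : MvPolynomial (Fin 6) R) * h)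
  · exact mem_deckIdeal_of_eq_mul a 2 (u := -1)
      (by simp [rel]; linear_combination (X 4 ^ 2 : MvPolynomial (Fin 6) R) * h)
  · exact mem_deckIdeal_of_eq_mul a 3 (u := -C (iR R)) (by simp [rel]; ring)
  · exact mem_deckIdeal_of_eq_mul a 4 (u := C (iR R)) (by simp [rel]; ring)
  · exact mem_deckIdeal_of_eq_mul a 5 (u := 1)
      (by simp [rel]; linear_combination (-(X 2 * X 4) : MvPolynomial (Fin 6) R) * h)
  · exact mem_deckIdeal_of_eq_mul a 6 (u := 1) (by simp [rel])

/-- The ideal is `τ₀`-stable. [cite: Kollar2007, §3.4.1] -/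
theorem deckIdeal_le_comap_tauPoly : deckIdeal a ≤ (deckIdeal a).comap (tauPoly R) := by
  rw [deckIdeal, Ideal.span_le]
  rintro _ ⟨k, rfl⟩
  exact tauPoly_rel_mem a k

/-- `τ₀⁴ = 1` on the polynomial ring. [cite: Kollar2007, §3.4.1] -/
theorem tauPoly_pow_four :
    (tauPoly R).comp ((tauPoly R).comp ((tauPoly R).comp (tauPoly R))) = AlgHom.id R _ := by
  have h := C_iR_mul_C_iR (R := R)
  refine MvPolynomial.algHom_ext fun i => ?_
  fin_cases i
  · simp
  · simp
  · simp only [AlgHom.comp_apply, AlgHom.id_apply, Fin.reduceFinMk, tauPoly_X2, map_mul, algHom_C, MvPolynomial.algebraMap_eq]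
    linear_combination ((C (iR R) * C (iR R) - 1) * X 2 : MvPolynomial (Fin 6) R) * h
  · simp
  · simp only [AlgHom.comp_apply, AlgHom.id_apply, Fin.reduceFinMk, tauPoly_X4, map_neg, map_mul, algHom_C, MvPolynomial.algebraMap_eq]
    linear_combination ((C (iR R) * C (iR R) - 1) * X 4 : MvPolynomial (Fin 6) R) * h
  · simp

/-- `j₀ ∘ j₀ = τ₀ ∘ τ₀` on the polynomial ring (`j² = τ²`). [cite: Kollar2007, §3.4.1] -/
theorem jPoly_comp_jPoly : (jPoly R).comp (jPoly R) = (tauPoly R).comp (tauPoly R) := by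
  have h := C_iR_mul_C_iR (R := R)
  refine MvPolynomial.algHom_ext fun i => ?_
  fin_cases i
  · simp
  · simp
  · simp only [AlgHom.comp_apply, Fin.reduceFinMk, jPoly_X2, jPoly_X4, tauPoly_X2, map_mul, algHom_C, MvPolynomial.algebraMap_eq]
    linear_combination (-(X 2) : MvPolynomial (Fin 6) R) * h
  · simp
  · simp only [AlgHom.comp_apply, Fin.reduceFinMk, jPoly_X4, jPoly_X2, tauPoly_X4, map_neg, map_mul, algHom_C, MvPolynomial.algebraMap_eq]
    linear_combination (-(X 4) : MvPolynomial (Fin 6) R) * h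
  · simp

/-- `τ₀ ∘ j₀ ∘ τ₀ = j₀` on the polynomial ring (`τ j τ = j`). [cite: Kollar2007, §3.4.1] -/
theorem tauPoly_comp_jPoly_comp_tauPoly : (tauPoly R).comp ((jPoly R).comp (tauPoly R)) = jPoly R := by
  have h := C_iR_mul_C_iR (R := R)
  refine MvPolynomial.algHom_ext fun i => ?_
  fin_cases i
  · simp
  · simp
  · simp only [AlgHom.comp_apply, Fin.reduceFinMk, tauPoly_X2, map_mul, algHom_C, MvPolynomial.algebraMap_eq, jPoly_X2, tauPoly_X4]
    linear_combination (-(X 4) : MvPolynomial (Fin 6) R) * h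
  · simp
  · simp only [AlgHom.comp_apply, Fin.reduceFinMk, tauPoly_X4, map_neg, map_mul, algHom_C, MvPolynomial.algebraMap_eq, jPoly_X4, tauPoly_X2]
    linear_combination (X 2 : MvPolynomial (Fin 6) R) * h
  · simp

end SubstTau



end Literature.AlgebraicGeometry.HodgeTheory.Q8Family

end
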